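import Summits.ValiantsHypothesis.ValiantsHypothesis.Theorems.ToricFixedPoints.Negative.FormDeborderingZExponent

/-!
# `ToricFixedPoints` / line `form_then_lift`, stub F1 at general `(n,m)`, `1 ≤ n < m`: the block torus
of `H₀(n,m)` forces a common `ℓ`-degree and common block margins on the support

Generalises `FormDeborderingMargins33` (the case `n = m = 3`) to all `1 ≤ n < m`: the diagonal
elements `diag(v)`, `v(i,j) = ρᵢ γⱼ s^{[(i,j)=(0,0)]}` with `ρ, γ` arbitrary non-zero on block indices
(`1` elsewhere) and `s^{m-n} ∏_{block} rᵢcᵢ = 1`, satisfy the four matrix conditions of hypothesis (4)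
of `stub_formDebordering` verbatim; comparing coefficients along three one-parameter families and using
homogeneity plus the `z`-torus (`h0_zExponent_eq`) gives:

* `h0_blockMargins_eq` — for a homogeneous `F` satisfying hypothesis (4) at `(n,m)`, any two monomials
  of `supp F` have the same exponent of `ℓ = X (0,0)`, the same row sum in every block row and the same
  column sum in every block column.

Together with `FormDeborderingZFree` (`z`-freeness) this is the complete typing analysis of F1's test
space (Disproof §6b) in the kernel: `F = ℓ^a · G(Y)` with `G` content-homogeneous on the `n × n` block.
Refuter/theory seat `val-width-5779-d1` (stmt-ValiantsHypothesis-5779).  VP ≠ VNP is not touched.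
-/

open MvPolynomial Finset
open Literature.Computability.AlgebraicComplexity
open Summit.ValiantsHypothesis.ValiantsHypothesis.Theorems.BorderApolarityToricFixedPoints
  (tli_coeff_linSubst_diagonal)

namespace Summit.ValiantsHypothesis.Cruxes.ToricFixedPoints.Negative

/-- The torus character of a monomial under `diag(ρ_{x.1} γ_{x.2} σₓ)` with `σ = s` at `(0,0)` and `1`
elsewhere factors through the `ℓ`-exponent and the full row and column sums. [folklore] -/
theorem prod_support_rankOne_pow_gen (m : ℕ) [NeZero m] (ρ γ : Fin m → ℂ) (s : ℂ)
    (d : (Fin m × Fin m) →₀ ℕ) :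
    ∏ x ∈ d.support, (ρ x.1 * γ x.2 * (if x = ((0 : Fin m), (0 : Fin m)) then s else 1)) ^ d x =
      s ^ d ((0 : Fin m), (0 : Fin m)) * ((∏ i : Fin m, ρ i ^ ∑ j : Fin m, d (i, j)) *
        ∏ j : Fin m, γ j ^ ∑ i : Fin m, d (i, j)) := by
  rw [Finset.prod_subset (Finset.subset_univ d.support)
    (fun x _ hx => by rw [Finsupp.notMem_support_iff.1 hx, pow_zero])]
  simp only [mul_pow, Finset.prod_mul_distrib]
  have h3 : ∏ x : Fin m × Fin m, (if x = ((0 : Fin m), (0 : Fin m)) then s else (1 : ℂ)) ^ d x =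
      s ^ d ((0 : Fin m), (0 : Fin m)) := by
    rw [← Finset.mul_prod_erase _ _ (Finset.mem_univ ((0 : Fin m), (0 : Fin m))), if_pos rfl,
      Finset.prod_eq_one fun x hx => by rw [if_neg (Finset.ne_of_mem_erase hx), one_pow], mul_one]
  rw [h3, mul_comm]
  congr 1
  congr 1
  · rw [Fintype.prod_prod_type]
    exact Finset.prod_congr rfl fun i _ => by simp only [Finset.prod_pow_eq_pow_sum]
  · rw [Fintype.prod_prod_type_right]
    exact Finset.prod_congr rfl fun j _ => by simp only [Finset.prod_pow_eq_pow_sum]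

/-- **One block-torus element at `(n,m)`, `n < m`.**  If `F` satisfies hypothesis (4) of
`stub_formDebordering` at `(n,m)`, `ρ, γ : Fin m → ℂ` are non-zero and equal to `1` below the block
(indices `< m-n`), and `s ≠ 0` with `s^{m-n} · ∏_{block i} ρᵢγᵢ = 1`, then the character
`s^{d₀₀} (∏ᵢ ρᵢ^{Rᵢ(d)}) (∏ⱼ γⱼ^{Cⱼ(d)})` takes the same value on any two monomials of `supp F`. [folklore] -/
theorem h0_blockCharacter_eq (n m : ℕ) [NeZero m] (hnm : n < m) {F : MvPolynomial (Fin m × Fin m) ℂ}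
    (hH : ∀ A : Matrix.GeneralLinearGroup (Fin m × Fin m) ℂ,
      let M : Matrix (Fin m × Fin m) (Fin m × Fin m) ℂ := A
      (∀ i j : Fin m × Fin m, M j i ≠ 0 →
        (fun p : Fin m × Fin m =>
            (if (m - n ≤ (p.1 : ℕ) ∧ m - n ≤ (p.2 : ℕ)) ∨ p = (0, 0) then 0 else m * m) +
              ((p.1 : ℕ) * m + (p.2 : ℕ))) j ≤
        (fun p : Fin m × Fin m =>
            (if (m - n ≤ (p.1 : ℕ) ∧ m - n ≤ (p.2 : ℕ)) ∨ p = (0, 0) then 0 else m * m) +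
              ((p.1 : ℕ) * m + (p.2 : ℕ))) i) →
      (∀ i j : Fin m × Fin m, ((m - n ≤ (i.1 : ℕ) ∧ m - n ≤ (i.2 : ℕ)) ∨ i = (0, 0)) →
        j ≠ i → M j i = 0) →
      (∀ i k j l : Fin m, m - n ≤ (i : ℕ) → m - n ≤ (k : ℕ) → m - n ≤ (j : ℕ) → m - n ≤ (l : ℕ) →
        M (i, j) (i, j) * M (k, l) (k, l) = M (i, l) (i, l) * M (k, j) (k, j)) →
      M (0, 0) (0, 0) ^ (m - n) * ∏ i ∈ Finset.univ.filter (fun i : Fin m => m - n ≤ (i : ℕ)),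
        M (i, i) (i, i) = 1 →
      ∃ e : ℂ, linSubst (Fin m × Fin m) ℂ M F = e • F)
    (ρ γ : Fin m → ℂ) (s : ℂ) (hρ : ∀ i, ρ i ≠ 0) (hγ : ∀ j, γ j ≠ 0) (hs : s ≠ 0)
    (hρ1 : ∀ i : Fin m, (i : ℕ) < m - n → ρ i = 1) (hγ1 : ∀ j : Fin m, (j : ℕ) < m - n → γ j = 1)
    (hnorm : s ^ (m - n) * ∏ i ∈ Finset.univ.filter (fun i : Fin m => m - n ≤ (i : ℕ)),
      (ρ i * γ i) = 1)
    {d d' : (Fin m × Fin m) →₀ ℕ} (hd : d ∈ F.support) (hd' : d' ∈ F.support) :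
    s ^ d ((0 : Fin m), (0 : Fin m)) * ((∏ i : Fin m, ρ i ^ ∑ j : Fin m, d (i, j)) *
        ∏ j : Fin m, γ j ^ ∑ i : Fin m, d (i, j)) =
      s ^ d' ((0 : Fin m), (0 : Fin m)) * ((∏ i : Fin m, ρ i ^ ∑ j : Fin m, d' (i, j)) *
        ∏ j : Fin m, γ j ^ ∑ i : Fin m, d' (i, j)) := by
  set v : Fin m × Fin m → ℂ :=
    fun x => ρ x.1 * γ x.2 * (if x = ((0 : Fin m), (0 : Fin m)) then s else 1) with hv
  have hv0 : ∀ x, v x ≠ 0 := by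
    intro x
    simp only [hv]
    refine mul_ne_zero (mul_ne_zero (hρ _) (hγ _)) ?_
    split_ifs
    · exact hs
    · exact one_ne_zero
  have hdet : (Matrix.diagonal v).det ≠ 0 := by
    rw [Matrix.det_diagonal]; exact Finset.prod_ne_zero_iff.2 fun x _ => hv0 x
  have h0blk : ¬ (m - n ≤ ((0 : Fin m) : ℕ)) := by simp; omega
  -- on block positions `v = ρ γ`
  have hblock : ∀ i j : Fin m, m - n ≤ (i : ℕ) → v (i, j) = ρ i * γ j := by
    intro i j hi
    simp only [hv]
    rw [if_neg, mul_one]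
    intro h
    rw [Prod.mk.injEq] at h
    rw [h.1] at hi
    exact h0blk hi
  have h00 : v ((0 : Fin m), (0 : Fin m)) = s := by
    simp only [hv, if_true]
    rw [hρ1 _ (by simp; omega), hγ1 _ (by simp; omega), one_mul, one_mul]
  set A : Matrix.GeneralLinearGroup (Fin m × Fin m) ℂ :=
    Matrix.GeneralLinearGroup.mkOfDetNeZero _ hdet with hAdef
  have hA : (A : Matrix (Fin m × Fin m) (Fin m × Fin m) ℂ) = Matrix.diagonal v := rfl
  have c1 : ∀ i j : Fin m × Fin m, (A : Matrix (Fin m × Fin m) (Fin m × Fin m) ℂ) j i ≠ 0 →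
      (fun p : Fin m × Fin m =>
          (if (m - n ≤ (p.1 : ℕ) ∧ m - n ≤ (p.2 : ℕ)) ∨ p = (0, 0) then 0 else m * m) +
            ((p.1 : ℕ) * m + (p.2 : ℕ))) j ≤
      (fun p : Fin m × Fin m =>
          (if (m - n ≤ (p.1 : ℕ) ∧ m - n ≤ (p.2 : ℕ)) ∨ p = (0, 0) then 0 else m * m) +
            ((p.1 : ℕ) * m + (p.2 : ℕ))) i := by
    intro i j h
    rw [hA] at h
    by_cases hji : j = i
    · rw [hji]
    · exact absurd (Matrix.diagonal_apply_ne v hji) h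
  have c2 : ∀ i j : Fin m × Fin m, ((m - n ≤ (i.1 : ℕ) ∧ m - n ≤ (i.2 : ℕ)) ∨ i = (0, 0)) →
      j ≠ i → (A : Matrix (Fin m × Fin m) (Fin m × Fin m) ℂ) j i = 0 := by
    intro i j _ hji
    rw [hA]
    exact Matrix.diagonal_apply_ne v hji
  have c3 : ∀ i k j l : Fin m, m - n ≤ (i : ℕ) → m - n ≤ (k : ℕ) → m - n ≤ (j : ℕ) →
      m - n ≤ (l : ℕ) →
      (A : Matrix (Fin m × Fin m) (Fin m × Fin m) ℂ) (i, j) (i, j) *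
          (A : Matrix (Fin m × Fin m) (Fin m × Fin m) ℂ) (k, l) (k, l) =
        (A : Matrix (Fin m × Fin m) (Fin m × Fin m) ℂ) (i, l) (i, l) *
          (A : Matrix (Fin m × Fin m) (Fin m × Fin m) ℂ) (k, j) (k, j) := by
    intro i k j l hi hk _ _
    rw [hA]
    simp only [Matrix.diagonal_apply_eq, hblock i j hi, hblock k l hk, hblock i l hi, hblock k j hk]
    ring
  have c4 : (A : Matrix (Fin m × Fin m) (Fin m × Fin m) ℂ) (0, 0) (0, 0) ^ (m - n) *
      ∏ i ∈ Finset.univ.filter (fun i : Fin m => m - n ≤ (i : ℕ)),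
        (A : Matrix (Fin m × Fin m) (Fin m × Fin m) ℂ) (i, i) (i, i) = 1 := by
    rw [hA]
    simp only [Matrix.diagonal_apply_eq, h00]
    rw [Finset.prod_congr rfl fun i hi => hblock i i (Finset.mem_filter.1 hi).2]
    exact hnorm
  obtain ⟨e, he⟩ := hH A c1 c2 c3 c4
  rw [hA] at he
  have key : ∀ {δ : (Fin m × Fin m) →₀ ℕ}, δ ∈ F.support →
      s ^ δ ((0 : Fin m), (0 : Fin m)) * ((∏ i : Fin m, ρ i ^ ∑ j : Fin m, δ (i, j)) *
        ∏ j : Fin m, γ j ^ ∑ i : Fin m, δ (i, j)) = e := by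
    intro δ hδ
    have h1 := congr_arg (coeff δ) he
    rw [tli_coeff_linSubst_diagonal, coeff_smul, smul_eq_mul, prod_support_rankOne_pow_gen] at h1
    exact mul_right_cancel₀ (mem_support_iff.1 hδ) h1
  exact (key hd).trans (key hd').symm


/-- `2^a (2⁻¹)^b = 2^{a'} (2⁻¹)^{b'}` in `ℂ` forces `a + b' = a' + b` (local copy of the `(3,3)` file's
lemma, kept private to avoid a route-file import). [folklore] -/
private theorem two_pow_mul_inv_pow_inj' {a b a' b' : ℕ}
    (h : (2 : ℂ) ^ a * (2⁻¹ : ℂ) ^ b = (2 : ℂ) ^ a' * (2⁻¹ : ℂ) ^ b') : a + b' = a' + b := by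
  have h2 : (2 : ℂ) ≠ 0 := two_ne_zero
  set q : ℂ := (2⁻¹ : ℂ) with hq
  have e1 : q ^ b * 2 ^ b = 1 := by rw [← mul_pow, hq, inv_mul_cancel₀ h2, one_pow]
  have e2 : q ^ b' * 2 ^ b' = 1 := by rw [← mul_pow, hq, inv_mul_cancel₀ h2, one_pow]
  have h' : (2 : ℂ) ^ (a + b') = (2 : ℂ) ^ (a' + b) := by
    calc (2 : ℂ) ^ (a + b') = 2 ^ a * (q ^ b * 2 ^ b) * 2 ^ b' := by rw [e1, mul_one, pow_add]
      _ = 2 ^ a * q ^ b * 2 ^ b * 2 ^ b' := by ring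
      _ = 2 ^ a' * q ^ b' * 2 ^ b * 2 ^ b' := by rw [h]
      _ = 2 ^ a' * 2 ^ b * (q ^ b' * 2 ^ b') := by ring
      _ = (2 : ℂ) ^ (a' + b) := by rw [e2, mul_one, pow_add]
  have h'' : ((2 ^ (a + b') : ℕ) : ℂ) = ((2 ^ (a' + b) : ℕ) : ℂ) := by push_cast; exact h'
  exact Nat.pow_right_injective (le_refl 2) (Nat.cast_inj.1 h'')

/-- `∏ₗ (update f i b l)^{eₗ} = b^{eᵢ} ∏_{l ≠ i} fₗ^{eₗ}`. [folklore] -/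
theorem prod_update_pow_eq {m : ℕ} (f : Fin m → ℂ) (i : Fin m) (b : ℂ) (e : Fin m → ℕ) :
    ∏ l, (Function.update f i b l) ^ e l = b ^ e i * ∏ l ∈ Finset.univ.erase i, f l ^ e l := by
  rw [← Finset.mul_prod_erase _ _ (Finset.mem_univ i), Function.update_self]
  congr 1
  exact Finset.prod_congr rfl fun l hl => by rw [Function.update_of_ne (Finset.ne_of_mem_erase hl)]

/-- `∏ₗ (update 1 i b l)^{eₗ} = b^{eᵢ}`. [folklore] -/
theorem prod_update_one_pow {m : ℕ} (i : Fin m) (b : ℂ) (e : Fin m → ℕ) :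
    ∏ l, (Function.update (fun _ => (1 : ℂ)) i b l) ^ e l = b ^ e i := by
  rw [prod_update_pow_eq]
  simp

/-- `∏ₗ (update (update 1 j b) j₀ b₀ l)^{eₗ} = b^{e_j} b₀^{e_{j₀}}` for `j ≠ j₀`. [folklore] -/
theorem prod_update_two_pow {m : ℕ} (j j₀ : Fin m) (hjj : j ≠ j₀) (b b₀ : ℂ) (e : Fin m → ℕ) :
    ∏ l, (Function.update (Function.update (fun _ => (1 : ℂ)) j b) j₀ b₀ l) ^ e l =
      b ^ e j * b₀ ^ e j₀ := by
  rw [prod_update_pow_eq, ← Finset.mul_prod_erase _ _ (Finset.mem_erase.2 ⟨hjj, Finset.mem_univ j⟩),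
    Function.update_self, Finset.prod_eq_one fun l hl => by
      rw [Function.update_of_ne (Finset.ne_of_mem_erase hl), one_pow], mul_one, mul_comm]

/-- **Common `ℓ`-degree and common block margins.**  `1 ≤ n < m`; `F` homogeneous satisfying
hypothesis (4) of `stub_formDebordering` at `(n,m)`: any two monomials of `supp F` have the same exponent
at `ℓ = X (0,0)`, the same (full) row sum in every block row `i ≥ m-n` and the same (full) column sum in
every block column. [folklore] -/
theorem h0_blockMargins_eq (n m : ℕ) [NeZero m] (hn : 1 ≤ n) (hnm : n < m) {k : ℕ}
    {F : MvPolynomial (Fin m × Fin m) ℂ} (hF : F.IsHomogeneous k)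
    (hH : ∀ A : Matrix.GeneralLinearGroup (Fin m × Fin m) ℂ,
      let M : Matrix (Fin m × Fin m) (Fin m × Fin m) ℂ := A
      (∀ i j : Fin m × Fin m, M j i ≠ 0 →
        (fun p : Fin m × Fin m =>
            (if (m - n ≤ (p.1 : ℕ) ∧ m - n ≤ (p.2 : ℕ)) ∨ p = (0, 0) then 0 else m * m) +
              ((p.1 : ℕ) * m + (p.2 : ℕ))) j ≤
        (fun p : Fin m × Fin m =>
            (if (m - n ≤ (p.1 : ℕ) ∧ m - n ≤ (p.2 : ℕ)) ∨ p = (0, 0) then 0 else m * m) +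
              ((p.1 : ℕ) * m + (p.2 : ℕ))) i) →
      (∀ i j : Fin m × Fin m, ((m - n ≤ (i.1 : ℕ) ∧ m - n ≤ (i.2 : ℕ)) ∨ i = (0, 0)) →
        j ≠ i → M j i = 0) →
      (∀ i k j l : Fin m, m - n ≤ (i : ℕ) → m - n ≤ (k : ℕ) → m - n ≤ (j : ℕ) → m - n ≤ (l : ℕ) →
        M (i, j) (i, j) * M (k, l) (k, l) = M (i, l) (i, l) * M (k, j) (k, j)) →
      M (0, 0) (0, 0) ^ (m - n) * ∏ i ∈ Finset.univ.filter (fun i : Fin m => m - n ≤ (i : ℕ)),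
        M (i, i) (i, i) = 1 →
      ∃ e : ℂ, linSubst (Fin m × Fin m) ℂ M F = e • F)
    {d d' : (Fin m × Fin m) →₀ ℕ} (hd : d ∈ F.support) (hd' : d' ∈ F.support) :
    d ((0 : Fin m), (0 : Fin m)) = d' ((0 : Fin m), (0 : Fin m)) ∧
      (∀ i : Fin m, m - n ≤ (i : ℕ) → ∑ j : Fin m, d (i, j) = ∑ j : Fin m, d' (i, j)) ∧
      (∀ j : Fin m, m - n ≤ (j : ℕ) → ∑ i : Fin m, d (i, j) = ∑ i : Fin m, d' (i, j)) := by
  have two0 : (2 : ℂ) ≠ 0 := two_ne_zero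
  have inv0 : (2⁻¹ : ℂ) ≠ 0 := inv_ne_zero two0
  set B : Finset (Fin m) := Finset.univ.filter (fun i : Fin m => m - n ≤ (i : ℕ)) with hB
  -- the last index is a block index
  set j₀ : Fin m := ⟨m - 1, by omega⟩ with hj₀
  have hj₀B : m - n ≤ (j₀ : ℕ) := by simp [hj₀]; omega
  have hj₀mem : j₀ ∈ B := Finset.mem_filter.2 ⟨Finset.mem_univ _, hj₀B⟩
  have h0B : ¬ (m - n ≤ ((0 : Fin m) : ℕ)) := by simp; omega
  -- abbreviations for the sums
  -- (T) rows: ρ = update 1 i 2, γ = update 1 j₀ 2⁻¹, s = 1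
  have hT : ∀ i : Fin m, m - n ≤ (i : ℕ) →
      ∑ j, d (i, j) + ∑ i, d' (i, j₀) = ∑ j, d' (i, j) + ∑ i, d (i, j₀) := by
    intro i hi
    have hiB : i ∈ B := Finset.mem_filter.2 ⟨Finset.mem_univ _, hi⟩
    have h := h0_blockCharacter_eq n m hnm hH (Function.update (fun _ => (1 : ℂ)) i 2)
      (Function.update (fun _ => (1 : ℂ)) j₀ 2⁻¹) 1
      (fun l => by
        rcases eq_or_ne l i with h | h
        · rw [h, Function.update_self]; exact two0
        · rw [Function.update_of_ne h]; exact one_ne_zero)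
      (fun l => by
        rcases eq_or_ne l j₀ with h | h
        · rw [h, Function.update_self]; exact inv0
        · rw [Function.update_of_ne h]; exact one_ne_zero)
      one_ne_zero
      (fun l hl => by rw [Function.update_of_ne]; rintro rfl; omega)
      (fun l hl => by rw [Function.update_of_ne]; rintro rfl; omega)
      (by
        rw [one_pow, one_mul, Finset.prod_mul_distrib, Finset.prod_update_of_mem hiB,
          Finset.prod_update_of_mem hj₀mem]
        simp)
      hd hd'
    rw [one_pow, one_pow, one_mul, one_mul, prod_update_one_pow, prod_update_one_pow,
      prod_update_one_pow, prod_update_one_pow] at h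
    exact two_pow_mul_inv_pow_inj' h
  -- (S) columns: ρ = 1, γ = update (update 1 j 2) j₀ 2⁻¹, s = 1
  have hS : ∀ j : Fin m, m - n ≤ (j : ℕ) → j ≠ j₀ →
      ∑ i, d (i, j) + ∑ i, d' (i, j₀) = ∑ i, d' (i, j) + ∑ i, d (i, j₀) := by
    intro j hj hjj
    have hjB : j ∈ B := Finset.mem_filter.2 ⟨Finset.mem_univ _, hj⟩
    have h := h0_blockCharacter_eq n m hnm hH (fun _ => (1 : ℂ))
      (Function.update (Function.update (fun _ => (1 : ℂ)) j 2) j₀ 2⁻¹) 1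
      (fun _ => one_ne_zero)
      (fun l => by
        rcases eq_or_ne l j₀ with h | h
        · rw [h, Function.update_self]; exact inv0
        · rw [Function.update_of_ne h]
          rcases eq_or_ne l j with h' | h'
          · rw [h', Function.update_self]; exact two0
          · rw [Function.update_of_ne h']; exact one_ne_zero)
      one_ne_zero
      (fun l hl => rfl)
      (fun l hl => by
        rw [Function.update_of_ne, Function.update_of_ne] <;> rintro rfl <;> omega)
      (by
        rw [one_pow, one_mul, Finset.prod_mul_distrib, Finset.prod_update_of_mem hj₀mem,
          Finset.prod_update_of_mem (Finset.mem_sdiff.2 ⟨hjB, by simpa using hjj⟩)]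
        simp)
      hd hd'
    rw [one_pow, one_pow, one_mul, one_mul, prod_update_two_pow j j₀ hjj,
      prod_update_two_pow j j₀ hjj] at h
    simp only [one_pow, Finset.prod_const_one, one_mul] at h
    exact two_pow_mul_inv_pow_inj' h
  -- (U) the `ℓ`-direction: ρ = update 1 j₀ (2⁻¹)^(m-n), γ = 1, s = 2
  have hU : d ((0 : Fin m), (0 : Fin m)) + (m - n) * ∑ j, d' (j₀, j) =
      d' ((0 : Fin m), (0 : Fin m)) + (m - n) * ∑ j, d (j₀, j) := by
    have h := h0_blockCharacter_eq n m hnm hH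
      (Function.update (fun _ => (1 : ℂ)) j₀ ((2⁻¹) ^ (m - n))) (fun _ => (1 : ℂ)) 2
      (fun l => by
        rcases eq_or_ne l j₀ with h | h
        · rw [h, Function.update_self]; exact pow_ne_zero _ inv0
        · rw [Function.update_of_ne h]; exact one_ne_zero)
      (fun _ => one_ne_zero) two0
      (fun l hl => by rw [Function.update_of_ne]; rintro rfl; omega)
      (fun l hl => rfl)
      (by
        rw [Finset.prod_mul_distrib, Finset.prod_update_of_mem hj₀mem]
        simp only [Finset.prod_const_one, mul_one]
        rw [← mul_pow, mul_inv_cancel₀ two0, one_pow])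
      hd hd'
    rw [prod_update_one_pow, prod_update_one_pow, ← pow_mul, ← pow_mul] at h
    simp only [one_pow, Finset.prod_const_one, mul_one] at h
    exact two_pow_mul_inv_pow_inj' h
  -- z-positions agree
  have hz : ∀ x : Fin m × Fin m, (x.1 : ℕ) < m - n → x ≠ ((0 : Fin m), (0 : Fin m)) → d x = d' x :=
    fun x hx hx0 => h0_zExponent_eq n m hH x (by
      rintro (⟨h1, -⟩ | h)
      · omega
      · exact hx0 h) hd hd'
  -- total degree
  have hdeg : ∀ {δ : (Fin m × Fin m) →₀ ℕ}, δ ∈ F.support → ∑ i : Fin m, ∑ j : Fin m, δ (i, j) = k := by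
    intro δ hδ
    have h := hF (mem_support_iff.1 hδ)
    rw [Finsupp.weight_apply, Finsupp.sum] at h
    simp only [Pi.one_apply, smul_eq_mul, mul_one] at h
    rw [← Fintype.sum_prod_type, ← h]
    exact (Finset.sum_subset (Finset.subset_univ _)
      (fun x _ hx => Finsupp.notMem_support_iff.1 hx)).symm
  -- non-block rows: only `ℓ` differs
  have hrow_nb : ∀ i : Fin m, (i : ℕ) < m - n →
      ∑ j, d (i, j) + (if i = 0 then d' ((0 : Fin m), (0 : Fin m)) else 0) =
        ∑ j, d' (i, j) + (if i = 0 then d ((0 : Fin m), (0 : Fin m)) else 0) := by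
    intro i hi
    by_cases hi0 : i = 0
    · subst hi0
      rw [if_pos rfl, if_pos rfl, ← Finset.add_sum_erase _ _ (Finset.mem_univ (0 : Fin m)),
        ← Finset.add_sum_erase _ (fun j => d' (0, j)) (Finset.mem_univ (0 : Fin m)),
        Finset.sum_congr rfl fun j hj => hz (0, j) hi (by
          rw [Ne, Prod.mk.injEq]; exact fun h => Finset.ne_of_mem_erase hj h.2)]
      ring
    · rw [if_neg hi0, if_neg hi0, Finset.sum_congr rfl fun j _ => hz (i, j) hi (by
          rw [Ne, Prod.mk.injEq]; exact fun h => hi0 h.1)]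
  have htop : ∑ i ∈ Finset.univ.filter (fun i : Fin m => ¬ m - n ≤ (i : ℕ)), ∑ j, d (i, j) +
      d' ((0 : Fin m), (0 : Fin m)) =
      ∑ i ∈ Finset.univ.filter (fun i : Fin m => ¬ m - n ≤ (i : ℕ)), ∑ j, d' (i, j) +
      d ((0 : Fin m), (0 : Fin m)) := by
    have h0mem : (0 : Fin m) ∈ Finset.univ.filter (fun i : Fin m => ¬ m - n ≤ (i : ℕ)) :=
      Finset.mem_filter.2 ⟨Finset.mem_univ _, h0B⟩
    have hsum := Finset.sum_congr rfl fun i (hi : i ∈ Finset.univ.filter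
        (fun i : Fin m => ¬ m - n ≤ (i : ℕ))) => hrow_nb i (by
          have := (Finset.mem_filter.1 hi).2; omega)
    rw [Finset.sum_add_distrib, Finset.sum_add_distrib, Finset.sum_ite_eq' _ (0 : Fin m),
      Finset.sum_ite_eq' _ (0 : Fin m), if_pos h0mem, if_pos h0mem] at hsum
    exact hsum
  have htot : ∑ i ∈ B, ∑ j, d (i, j) +
      ∑ i ∈ Finset.univ.filter (fun i : Fin m => ¬ m - n ≤ (i : ℕ)), ∑ j, d (i, j) =
      ∑ i ∈ B, ∑ j, d' (i, j) +
      ∑ i ∈ Finset.univ.filter (fun i : Fin m => ¬ m - n ≤ (i : ℕ)), ∑ j, d' (i, j) := by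
    rw [hB, Finset.sum_filter_add_sum_filter_not, Finset.sum_filter_add_sum_filter_not, hdeg hd,
      hdeg hd']
  -- sum of (T) over the block rows
  have hcard : B.card = n := by
    have : B = (Finset.univ : Finset (Fin n)).image
        (fun a : Fin n => (⟨m - n + (a : ℕ), by omega⟩ : Fin m)) := by
      ext i
      simp only [hB, Finset.mem_filter, Finset.mem_univ, true_and, Finset.mem_image]
      constructor
      · intro hi
        exact ⟨⟨(i : ℕ) - (m - n), by omega⟩, Fin.ext (by simp; omega)⟩
      · rintro ⟨a, rfl⟩
        simp
    rw [this, Finset.card_image_of_injective _ fun a b hab => by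
      rw [Fin.ext_iff] at hab ⊢; simp at hab; omega]
    simp
  have hTsum : ∑ i ∈ B, ∑ j, d (i, j) + n * ∑ i, d' (i, j₀) =
      ∑ i ∈ B, ∑ j, d' (i, j) + n * ∑ i, d (i, j₀) := by
    have hsum := Finset.sum_congr rfl fun i (hi : i ∈ B) => hT i (Finset.mem_filter.1 hi).2
    rw [Finset.sum_add_distrib, Finset.sum_add_distrib, Finset.sum_const, Finset.sum_const, hcard,
      smul_eq_mul, smul_eq_mul] at hsum
    exact hsum
  -- integer bookkeeping
  have hTj₀ := hT j₀ hj₀B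
  have hmn : m - n + n = m := by omega
  have hC : ∑ i, d (i, j₀) = ∑ i, d' (i, j₀) := by
    have key : (((m - n : ℕ) : ℤ) + n) *
        (∑ i, ((d (i, j₀) : ℕ) : ℤ) - ∑ i, ((d' (i, j₀) : ℕ) : ℤ)) = 0 := by
      zify at hTsum hTj₀ hU htot htop
      linear_combination (-1 : ℤ) * hTsum + htot - htop - hU - ((m - n : ℕ) : ℤ) * hTj₀
    have hm0 : (((m - n : ℕ) : ℤ) + n) ≠ 0 := by omega
    have h3 := (mul_eq_zero.1 key).resolve_left hm0
    zify
    linarith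
  refine ⟨?_, fun i hi => ?_, fun j hj => ?_⟩
  · have h1 := hT j₀ hj₀B
    have h2 : ∑ j, d (j₀, j) = ∑ j, d' (j₀, j) := by omega
    rw [h2] at hU
    omega
  · have h1 := hT i hi
    omega
  · by_cases hjj : j = j₀
    · rw [hjj]; exact hC
    · have h1 := hS j hj hjj
      omega

end Summit.ValiantsHypothesis.Cruxes.ToricFixedPoints.Negative
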